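import Summits.Ventures.PercRepro.C026HubPairModel

/-!
# Hub-pair graphs, III: the branch rotation and its decoder on the finite model (p5, gen 11)

mine-3's rotation `Ψ` of a `KL` source (§25.4) and its decoder (§25.6), for a graph supported on
`ι 0, …, ι (n-1)` (marks `0, 1, 2`, non-marks `≥ 3`), written as **rules on edge classes**: the class
of an edge is the ordered pair `(min i j, max i j)` of the indices of its endpoints, and the new state
of an edge depends only on its class, its old state and the **rows** of the configuration:

* `rot n O C i` — the non-mark `i` is rotated: it lies in `M = Com_c` and has an `a`- or `b`-edge
  (a *root*), or it is joined by an open copy to a root and has no closed `c`-edge (*dragged*);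
* the rule `ruleO`: every `c`-edge at a rotated vertex is closed (α); every copy between a rotated
  and an unrotated non-mark is closed (the cut β); at ONE vertex of every branch (the least rotated
  vertex with an `a`-edge, else with a `b`-edge — `opnA`, `opnB`) every `a`-edge (resp. `b`-edge) is
  opened (γ; opening all copies keeps the map injective and the image type unchanged);
* `imgO`, `imgC` — the rows of the image, computed from the rows of the source (`oRows_psi`,
  `cRows_psi`: the concrete rotation `psi` commutes with the abstract one);
* the decoder `rotD'` (rotated = in `K' ∪ L'` with a closed `c`-edge, or a closed copy to an `M'`-vertex
  with a closed `c`-edge, or an open copy to such a vertex) and `ruleD`; **`dec_psi`**: the decoder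
  inverts `psi` whenever the abstract decoder recovers the rotated set and the source is
  *determined* on the touched classes — two facts checked over the whole model by `decide +kernel`
  in `C026HubPairCheck.lean`.
-/

namespace PercRepro

namespace PairModel

/-! ### The rotation on rows -/

/-- The non-marks of the model are the indices `≥ 3`. -/
def nonMark (i : ℕ) : Bool := decide (3 ≤ i)

/-- `i` has an `a`-edge. -/
def hasA (O C : Rows) (i : ℕ) : Bool := adj O i 0 || adj C i 0

/-- `i` has a `b`-edge. -/
def hasB (O C : Rows) (i : ℕ) : Bool := adj O i 1 || adj C i 1

/-- A root: a non-mark in `M` with an `a`- or `b`-edge. -/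
def rot0 (n : ℕ) (O C : Rows) (i : ℕ) : Bool :=
  nonMark i && (reach n O 2).testBit i && (hasA O C i || hasB O C i)

/-- Rotated: a root, or dragged along an open copy by a root (no closed `c`-edge). -/
def rot (n : ℕ) (O C : Rows) (i : ℕ) : Bool :=
  rot0 n O C i || (nonMark i && (reach n O 2).testBit i && !adj C i 2 &&
    (List.range n).any fun j => nonMark j && adj O i j && rot0 n O C j)

/-- The branches: open copies between rotated vertices. -/
def brRows (n : ℕ) (O C : Rows) : Rows :=
  (List.range n).map fun i => maskOf n fun j => rot n O C i && rot n O C j && adj O i j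

/-- `i` and `j` lie in one branch. -/
def brB (n : ℕ) (O C : Rows) (i j : ℕ) : Bool := reachB n (brRows n O C) i j

/-- The `a`-edges at `i` are opened: `i` is the least rotated vertex of its branch with an `a`-edge. -/
def opnA (n : ℕ) (O C : Rows) (i : ℕ) : Bool :=
  rot n O C i && hasA O C i && (List.range i).all fun j => !(brB n O C i j && hasA O C j)

/-- The `b`-edges at `i` are opened: no `a`-edge in the branch, `i` its least vertex with a `b`-edge. -/
def opnB (n : ℕ) (O C : Rows) (i : ℕ) : Bool :=
  rot n O C i && hasB O C i && ((List.range n).all fun j => !(brB n O C i j && hasA O C j)) &&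
    (List.range i).all fun j => !(brB n O C i j && hasB O C j)

/-- The class `(2, q)` of a `c`-edge at a rotated vertex (α). -/
def cCond (n : ℕ) (O C : Rows) (p q : ℕ) : Bool := (p == 2) && rot n O C q

/-- The class of a copy between a rotated and an unrotated non-mark (the cut β). -/
def cutCond (n : ℕ) (O C : Rows) (p q : ℕ) : Bool :=
  nonMark p && (p != q) && (rot n O C p != rot n O C q)

/-- The class of the mark edges opened at `q` (γ). -/
def opnCond (n : ℕ) (O C : Rows) (p q : ℕ) : Bool :=
  ((p == 0) && opnA n O C q) || ((p == 1) && opnB n O C q)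

/-- **The rule**: the new state of an edge of class `(p, q)` (`p ≤ q`) from its old state `b`. -/
def ruleO (n : ℕ) (O C : Rows) (p q : ℕ) (b : Bool) : Bool :=
  if cCond n O C p q || cutCond n O C p q then false
  else if opnCond n O C p q then true else b

/-- The open rows of the image. -/
def imgO (n : ℕ) (O C : Rows) : Rows :=
  (List.range n).map fun i => maskOf n fun j =>
    decide (i ≠ j) &&
      (if cCond n O C (min i j) (max i j) || cutCond n O C (min i j) (max i j) then false
        else if opnCond n O C (min i j) (max i j) then (adj O i j || adj C i j) else adj O i j)

/-- The closed rows of the image. -/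
def imgC (n : ℕ) (O C : Rows) : Rows :=
  (List.range n).map fun i => maskOf n fun j =>
    decide (i ≠ j) &&
      (if cCond n O C (min i j) (max i j) || cutCond n O C (min i j) (max i j) then
        (adj O i j || adj C i j)
        else if opnCond n O C (min i j) (max i j) then false else adj C i j)

/-! ### The decoder on rows -/

/-- The decoder's roots: a non-mark of `K' ∪ L'` with a closed `c`-edge, or with a closed copy to an
`M'`-vertex having a closed `c`-edge. -/
def rotD (n : ℕ) (O' C' : Rows) (i : ℕ) : Bool :=
  nonMark i && ((reach n O' 0).testBit i || (reach n O' 1).testBit i) &&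
    (adj C' i 2 || (List.range n).any fun j =>
      nonMark j && adj C' i j && (reach n O' 2).testBit j && adj C' j 2)

/-- The decoder's rotated set: the roots and their open-copy partners. -/
def rotD' (n : ℕ) (O' C' : Rows) (i : ℕ) : Bool :=
  rotD n O' C' i || (nonMark i && (List.range n).any fun j => nonMark j && adj O' i j && rotD n O' C' j)

/-- **The decoding rule**: the old state of an edge of class `(p, q)` from its new state `b`. -/
def ruleD (n : ℕ) (O' C' : Rows) (p q : ℕ) (b : Bool) : Bool :=
  if (p == 2) && rotD' n O' C' q then true
  else if nonMark p && (p != q) && (rotD' n O' C' p != rotD' n O' C' q) then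
    (if rotD' n O' C' p then adj C' q 2 else adj C' p 2)
  else if ((p == 0) || (p == 1)) && rotD' n O' C' q then false else b

/-- `maskOf` depends only on the values below `n`. -/
theorem maskOf_congr {n : ℕ} {p q : ℕ → Bool} (h : ∀ j < n, p j = q j) :
    maskOf n p = maskOf n q := by
  apply Nat.eq_of_testBit_eq
  intro j
  rw [testBit_maskOf, testBit_maskOf]
  by_cases hj : j < n
  · simp [hj, h j hj]
  · simp [hj]

/-- The entries of the image rows. -/
theorem adj_imgO {n : ℕ} (O C : Rows) {i : ℕ} (hi : i < n) (j : ℕ) :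
    adj (imgO n O C) i j = (decide (j < n) && (decide (i ≠ j) &&
      (if cCond n O C (min i j) (max i j) || cutCond n O C (min i j) (max i j) then false
        else if opnCond n O C (min i j) (max i j) then (adj O i j || adj C i j)
        else adj O i j))) := by
  simp [adj, imgO, row_map_range hi, testBit_maskOf]

/-- The entries of the image rows (closed). -/
theorem adj_imgC {n : ℕ} (O C : Rows) {i : ℕ} (hi : i < n) (j : ℕ) :
    adj (imgC n O C) i j = (decide (j < n) && (decide (i ≠ j) &&
      (if cCond n O C (min i j) (max i j) || cutCond n O C (min i j) (max i j) then
        (adj O i j || adj C i j)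
        else if opnCond n O C (min i j) (max i j) then false else adj C i j))) := by
  simp [adj, imgC, row_map_range hi, testBit_maskOf]

end PairModel

namespace MultiGraph

open PairModel

variable {V E : Type*} {G : MultiGraph V E} {ι : ℕ → V} {n : ℕ}

/-! ### The concrete rotation and decoder -/

open Classical in
/-- The index of a supported vertex (`n` for the others). -/
noncomputable def idx (ι : ℕ → V) (n : ℕ) (v : V) : ℕ :=
  if h : ∃ k, k < n ∧ ι k = v then Classical.choose h else n

/-- The index of `ι k`. -/
theorem idx_apply (hinj : InjBelow ι n) {k : ℕ} (hk : k < n) : idx ι n (ι k) = k := by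
  unfold idx
  have h : ∃ k', k' < n ∧ ι k' = ι k := ⟨k, hk, rfl⟩
  rw [dif_pos h]
  exact hinj _ (Classical.choose_spec h).1 k hk (Classical.choose_spec h).2

/-- The class of an edge: the ordered pair of the indices of its endpoints. -/
noncomputable def cls (G : MultiGraph V E) (ι : ℕ → V) (n : ℕ) (e : E) : ℕ × ℕ :=
  (min (idx ι n (G.fst e)) (idx ι n (G.snd e)), max (idx ι n (G.fst e)) (idx ι n (G.snd e)))

/-- The class of an edge joining `ι i` and `ι j`. -/
theorem cls_of_joins (hinj : InjBelow ι n) {e : E} {i j : ℕ} (hi : i < n) (hj : j < n)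
    (h : G.Joins e (ι i) (ι j)) : G.cls ι n e = (min i j, max i j) := by
  unfold cls
  rcases h with ⟨h1, h2⟩ | ⟨h1, h2⟩
  · rw [h1, h2, idx_apply hinj hi, idx_apply hinj hj]
  · rw [h1, h2, idx_apply hinj hj, idx_apply hinj hi, min_comm, max_comm]

/-- **The rotation** `Ψ`: every edge follows the rule of its class. -/
noncomputable def psi (G : MultiGraph V E) (ι : ℕ → V) (n : ℕ) (ω : Config E) : Config E :=
  fun e => ruleO n (G.oRows ι n ω) (G.cRows ι n ω) (G.cls ι n e).1 (G.cls ι n e).2 (ω e)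

/-- **The decoder**. -/
noncomputable def dec (G : MultiGraph V E) (ι : ℕ → V) (n : ℕ) (T : Config E) : Config E :=
  fun e => ruleD n (G.oRows ι n T) (G.cRows ι n T) (G.cls ι n e).1 (G.cls ι n e).2 (T e)

/-- The rotation on an edge joining `ι i`, `ι j`. -/
theorem psi_apply_of_joins (hinj : InjBelow ι n) {ω : Config E} {e : E} {i j : ℕ} (hi : i < n)
    (hj : j < n) (h : G.Joins e (ι i) (ι j)) :
    G.psi ι n ω e = ruleO n (G.oRows ι n ω) (G.cRows ι n ω) (min i j) (max i j) (ω e) := by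
  unfold psi
  rw [cls_of_joins hinj hi hj h]

/-- The decoder on an edge joining `ι i`, `ι j`. -/
theorem dec_apply_of_joins (hinj : InjBelow ι n) {T : Config E} {e : E} {i j : ℕ} (hi : i < n)
    (hj : j < n) (h : G.Joins e (ι i) (ι j)) :
    G.dec ι n T e = ruleD n (G.oRows ι n T) (G.cRows ι n T) (min i j) (max i j) (T e) := by
  unfold dec
  rw [cls_of_joins hinj hi hj h]

/-- Every edge joins two supported vertices. -/
theorem exists_joins (hsup : G.Supported ι n) (e : E) :
    ∃ i < n, ∃ j < n, G.Joins e (ι i) (ι j) := by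
  obtain ⟨⟨i, hi, hf⟩, ⟨j, hj, hs⟩⟩ := hsup e
  exact ⟨i, hi, j, hj, Or.inl ⟨hf, hs⟩⟩

/-- Some edge joins `ι i`, `ι j` iff an open or a closed one does. -/
theorem exists_joins_iff {ω : Config E} {i j : ℕ} (hi : i < n) (hj : j < n) (hij : i ≠ j) :
    (∃ e, G.Joins e (ι i) (ι j)) ↔
      (adj (G.oRows ι n ω) i j = true ∨ adj (G.cRows ι n ω) i j = true) := by
  rw [adj_oRows ω hi j, adj_cRows ω hi j]
  constructor
  · rintro ⟨e, he⟩
    cases h : ω e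
    · exact Or.inr ⟨hj, hij, e, h, he⟩
    · exact Or.inl ⟨hj, hij, e, h, he⟩
  · rintro (⟨_, _, e, _, he⟩ | ⟨_, _, e, _, he⟩) <;> exact ⟨e, he⟩

variable (hinj : InjBelow ι n)
include hinj

/-- **The rotation commutes with its model**: the open rows of `Ψ ω` are `imgO` of the rows of `ω`. -/
theorem oRows_psi (ω : Config E) :
    G.oRows ι n (G.psi ι n ω) = imgO n (G.oRows ι n ω) (G.cRows ι n ω) := by
  classical
  set O := G.oRows ι n ω with hO
  set C := G.cRows ι n ω with hC
  unfold oRows imgO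
  refine List.map_congr_left fun i hi => maskOf_congr fun j hj => ?_
  rw [List.mem_range] at hi
  by_cases hij : i = j
  · simp [hij]
  · have hne : decide (i ≠ j) = true := by simp [hij]
    rw [hne, Bool.true_and]
    apply Bool.eq_iff_iff.mpr
    rw [decide_eq_true_iff]
    have hpsi : ∀ e, G.Joins e (ι i) (ι j) → G.psi ι n ω e =
        (if cCond n O C (min i j) (max i j) || cutCond n O C (min i j) (max i j) then false
          else if opnCond n O C (min i j) (max i j) then true else ω e) :=
      fun e he => by rw [psi_apply_of_joins hinj hi hj he]; rfl
    split_ifs with h1 h2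
    · simp only [iff_false, not_and, not_exists]
      intro _ e hpe he
      rw [hpsi e he, if_pos h1] at hpe
      exact absurd hpe (by decide)
    · rw [Bool.or_eq_true, hO, hC, ← exists_joins_iff (ω := ω) hi hj hij]
      constructor
      · rintro ⟨_, e, _, he⟩
        exact ⟨e, he⟩
      · rintro ⟨e, he⟩
        refine ⟨hij, e, ?_, he⟩
        rw [hpsi e he, if_neg h1, if_pos h2]
    · rw [hO, adj_oRows ω hi j]
      constructor
      · rintro ⟨_, e, hpe, he⟩
        rw [hpsi e he, if_neg h1, if_neg h2] at hpe
        exact ⟨hj, hij, e, hpe, he⟩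
      · rintro ⟨_, _, e, hpe, he⟩
        refine ⟨hij, e, ?_, he⟩
        rw [hpsi e he, if_neg h1, if_neg h2]
        exact hpe

/-- **The rotation commutes with its model** (closed rows). -/
theorem cRows_psi (ω : Config E) :
    G.cRows ι n (G.psi ι n ω) = imgC n (G.oRows ι n ω) (G.cRows ι n ω) := by
  classical
  set O := G.oRows ι n ω with hO
  set C := G.cRows ι n ω with hC
  unfold cRows imgC
  refine List.map_congr_left fun i hi => maskOf_congr fun j hj => ?_
  rw [List.mem_range] at hi
  by_cases hij : i = j
  · simp [hij]
  · have hne : decide (i ≠ j) = true := by simp [hij]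
    rw [hne, Bool.true_and]
    apply Bool.eq_iff_iff.mpr
    rw [decide_eq_true_iff]
    have hpsi : ∀ e, G.Joins e (ι i) (ι j) → G.psi ι n ω e =
        (if cCond n O C (min i j) (max i j) || cutCond n O C (min i j) (max i j) then false
          else if opnCond n O C (min i j) (max i j) then true else ω e) :=
      fun e he => by rw [psi_apply_of_joins hinj hi hj he]; rfl
    split_ifs with h1 h2
    · rw [Bool.or_eq_true, hO, hC, ← exists_joins_iff (ω := ω) hi hj hij]
      constructor
      · rintro ⟨_, e, _, he⟩
        exact ⟨e, he⟩
      · rintro ⟨e, he⟩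
        refine ⟨hij, e, ?_, he⟩
        rw [hpsi e he, if_pos h1]
    · simp only [iff_false, not_and, not_exists]
      intro _ e hpe he
      rw [hpsi e he, if_neg h1, if_pos h2] at hpe
      exact absurd hpe (by decide)
    · rw [hC, adj_cRows ω hi j]
      constructor
      · rintro ⟨_, e, hpe, he⟩
        rw [hpsi e he, if_neg h1, if_neg h2] at hpe
        exact ⟨hj, hij, e, hpe, he⟩
      · rintro ⟨_, _, e, hpe, he⟩
        refine ⟨hij, e, ?_, he⟩
        rw [hpsi e he, if_neg h1, if_neg h2]
        exact hpe

end MultiGraph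

end PercRepro
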